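import Summits.QuantumFields.YangMills.Theorems.BalabanUVNodesN21AvgKernelEquivariance

/-!
# N21 (NE7c) · infrastructure, II: the `k`-STEP TOWER — gauge covariance of `T4AveragingDisintegration.towerMap` under a COHERENT family of
# lifted gauge transformations, and the equivariance of the tower's conditional kernel ∕ marginal density ∕ kernel transport

Track A of `YM-PLAN.md` (cell `pub-ymgap`, HUMAN RULING D-0062 ∕ D-0149 width seats), node **N21**; WIDTH SEAT `pub-ymgap-dag-n21-w2` (gen 2), file 12.
THEOREMS ONLY: 0 `def`, 0 `sorry`; COUNT-NEUTRAL; `--kind proof --supports stmt-QuantumFields-20544 --as helper`.  Imports ONLY my file 10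
`…N21AvgKernelEquivariance` (p605176: §1 generic `condLaw_map_ae_eq` ∕ §3 `margDensity_comp_ae_eq` ∕ `kernelTransport_apply_ae_eq` at ANY intertwining pair),
hence `T4AveragingDisintegration` (`towerMap`, `towerMap_succ`, `measurable_towerMap`, `towerAC`) and `B12RTGaugeInvariance254` (`liftTransf`,
`avg_gaugeAct_liftTransf`, `measurable_gaugeAct`, `measurePreserving_gaugeAct`).  NO Theses import.  Restates nothing; cites by name.

WHY.  `T4AveragingDisintegration` §5∕§6 present a multi-step run through the EXACT `k`-step tower map `towerMap avg lvl k : GaugeField P lvl G →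
GaugeField P (lvl + k) G` (joint laws `jointLaw dU (Tr ∘ Ū)`, `perfDensity`, `towerAC`); a (2.18) term of record integrates several old levels.  File 10 typed the
ONE-STEP gauge equivariance; this file supplies the tower: a coarse gauge transformation `v` at level `lvl + k` is realised on every lower level by the
ITERATED block-constant lifts — a COHERENT FAMILY `u : (i : ℕ) → GaugeTransf P (lvl + i) G`, `u i = liftTransf (u (i+1))` for `i < k` (the consumer builds it
for its `k` by `k` applications of `liftTransf`; no `def` is introduced here) — and the tower map intertwines `U ↦ U^{u 0}` with `V ↦ V^{u k}`.

WHAT IS PROVED ([folklore]; induction on `k` + file 10 BY NAME).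
* §1 `towerMap_gaugeAct` — COVARIANCE OF THE TOWER: for level-indexed covariant averagings `av i` in the standing range `lvl + k ≤ m + K` and a coherent family `u`,
  `towerMap (fun i => (av i).avg) lvl k (U^{u 0}) = (towerMap … k U)^{u k}` (`avg_gaugeAct_liftTransf` at each level).
* §2 ★ `condLaw_towerMap_map_gaugeAct_ae_eq` — the tower's conditional kernel is gauge-equivariant: `∀ᵐ V ∂(dU.map (towerMap … k)),
  (condLaw dU (towerMap … k) V).map (·^{u 0}) = condLaw dU (towerMap … k) (V^{u k})`; set ∕ `∫⁻` forms.
* §3 `margDensity_towerMap_gaugeAct_ae_eq` · ★ `kernelTransport_towerMap_gaugeAct_ae_eq` — under one-step `HaarAC` at every level (`towerAC`), the tower's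
  marginal density is gauge invariant `dV`-a.e. and its kernel transport commutes with the pair FOR EVERY measurable density:
  `∀ᵐ V ∂dV_{lvl+k}, (T_k ρ)(V^{u k}) = (T_k (ρ ∘ (·)^{u 0}))(V)`.
* §4 INSTANCES AT THE AVERAGING OF RECORD: `avgKernel_expMeanLogSU_map_gaugeAct_ae_eq` · `transportK_expMeanLogSU_gaugeAct_ae_eq` — file 10's ★★ at Bałaban's
  exp-mean-log block averaging (0.4) on `SU(N)` (`BlockAveraging.blockAvg ExpMeanLog.expMeanLogSU`), every `N ≥ 1`, UNCONDITIONAL in the standing range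
  (`measurable_avgFun`, `haarAC_avgFun_expMeanLogSU_SUN` BY NAME) — the one-step hypotheses `havg` ∕ `hac` of file 10 are thereby inhabited at the record's averaging.

HONEST FRAMING.  [folklore] bookkeeping (an induction and three applications of file 10); the coherent family is DATA supplied by the consumer; transitivity NOT
claimed; nothing of Bałaban's asserted; (M1) ∕ NE7c NOT PRINTED ∕ NOT proved; **N21 NOT discharged**; K3⁷ NOT claimed; counts UNMOVED (typed 28∕28 · discharged
5∕27); one finite four-torus programme at fixed `ε` — NOT ℝ⁴, NOT infinite volume, NOT OS, NOT a mass gap, NOT Clay.  No decl below carries a cite tag.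
-/

noncomputable section

open MeasureTheory ProbabilityTheory
open scoped ENNReal

namespace Summit.QuantumFields.YangMills.Theorems.N21AvgKernelEquivariance

open Literature.MathematicalPhysics.QuantumFieldTheory.Balaban1983to89
open T4AveragingDisintegration (condLaw towerMap towerMap_zero towerMap_succ measurable_towerMap towerAC margDensity kernelTransport)
open T4FiniteEpsInhabited (HaarAC)
open B12RTGaugeInvariance254 (invTransf liftTransf gaugeAct_inv_gaugeAct gaugeAct_gaugeAct_inv avg_gaugeAct_liftTransf
  measurable_gaugeAct measurePreserving_gaugeAct)

variable {P : Params} {G : Type*} [GaugeGroup G]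

/-! ## §1 Covariance of the tower map under a coherent family of lifted gauge transformations -/

/-- **THE TOWER MAP IS GAUGE COVARIANT.**  For covariant one-step averagings `av i` (levels `lvl, …, lvl + k − 1`, standing range `lvl + k ≤ m + K`) and a
COHERENT family of gauge transformations `u i` on the levels `lvl + i` (`u i = liftTransf (u (i+1))` for `i < k`: each is the block-constant lift of the next),
`towerMap (U^{u 0}) = (towerMap U)^{u k}`. [folklore] -/
theorem towerMap_gaugeAct (av : (i : ℕ) → Averaging P i G) (lvl : ℕ) :
    ∀ (k : ℕ), lvl + k ≤ P.m + P.K → ∀ (u : (i : ℕ) → GaugeTransf P (lvl + i) G),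
      (∀ i, i < k → u i = liftTransf (j := lvl + i) (u (i + 1))) → ∀ U : GaugeField P lvl G,
        towerMap (fun i => (av i).avg) lvl k (GaugeField.gaugeAct (u 0) U)
          = GaugeField.gaugeAct (u k) (towerMap (fun i => (av i).avg) lvl k U)
  | 0, _, _, _, _ => rfl
  | k + 1, hr, u, hu, U => by
    rw [towerMap_succ, towerMap_succ, towerMap_gaugeAct av lvl k (by omega) u (fun i hi => hu i (by omega)) U,
      hu k (Nat.lt_succ_self k)]
    exact avg_gaugeAct_liftTransf (by omega) (av (lvl + k)) (u (k + 1)) _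

/-! ## §2 The tower's conditional kernel is gauge-equivariant -/

section Kernel

variable [MeasurableSpace G] [HaarData G] [MeasurableMul₂ G] [StandardBorelSpace G]

/-- ★ **GAUGE EQUIVARIANCE OF THE `k`-STEP CONDITIONAL KERNEL** (the law of the level-`lvl` field GIVEN its `k`-fold average): for `(dU.map towerMap)`-a.e. `V`,
`(condLaw dU towerMap V).map (·^{u 0}) = condLaw dU towerMap (V^{u k})` — file 10's `condLaw_map_ae_eq` at the pair `(·^{u 0}, ·^{u k})`, which §1 intertwines and
`measurePreserving_gaugeAct` makes measure preserving. [folklore] -/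
theorem condLaw_towerMap_map_gaugeAct_ae_eq (av : (i : ℕ) → Averaging P i G) (havg : ∀ i, Measurable (av i).avg) (lvl k : ℕ)
    (hr : lvl + k ≤ P.m + P.K) (u : (i : ℕ) → GaugeTransf P (lvl + i) G) (hu : ∀ i, i < k → u i = liftTransf (j := lvl + i) (u (i + 1))) :
    ∀ᵐ V ∂((fieldMeasure P lvl G).map (towerMap (fun i => (av i).avg) lvl k)),
      (condLaw (fieldMeasure P lvl G) (towerMap (fun i => (av i).avg) lvl k) V).map (GaugeField.gaugeAct (u 0))
        = condLaw (fieldMeasure P lvl G) (towerMap (fun i => (av i).avg) lvl k) (GaugeField.gaugeAct (u k) V) := by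
  let S : GaugeField P (lvl + k) G ≃ᵐ GaugeField P (lvl + k) G :=
    { toFun := GaugeField.gaugeAct (u k)
      invFun := GaugeField.gaugeAct (invTransf (u k))
      left_inv := gaugeAct_inv_gaugeAct (u k)
      right_inv := gaugeAct_gaugeAct_inv (u k)
      measurable_toFun := measurable_gaugeAct (u k)
      measurable_invFun := measurable_gaugeAct (invTransf (u k)) }
  exact condLaw_map_ae_eq (fieldMeasure P lvl G) (measurable_towerMap _ havg lvl k) (measurable_gaugeAct (u 0)) S
    (towerMap_gaugeAct av lvl k hr u hu) (measurePreserving_gaugeAct (u 0)).map_eq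

/-- Set form: `condLaw dU towerMap (V^{u k}) A = condLaw dU towerMap V ((·^{u 0}) ⁻¹' A)` a.e., every measurable `A`. [folklore] -/
theorem condLaw_towerMap_gaugeAct_apply_ae_eq_preimage (av : (i : ℕ) → Averaging P i G) (havg : ∀ i, Measurable (av i).avg) (lvl k : ℕ)
    (hr : lvl + k ≤ P.m + P.K) (u : (i : ℕ) → GaugeTransf P (lvl + i) G) (hu : ∀ i, i < k → u i = liftTransf (j := lvl + i) (u (i + 1)))
    {A : Set (GaugeField P lvl G)} (hA : MeasurableSet A) :
    ∀ᵐ V ∂((fieldMeasure P lvl G).map (towerMap (fun i => (av i).avg) lvl k)),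
      condLaw (fieldMeasure P lvl G) (towerMap (fun i => (av i).avg) lvl k) (GaugeField.gaugeAct (u k) V) A
        = condLaw (fieldMeasure P lvl G) (towerMap (fun i => (av i).avg) lvl k) V (GaugeField.gaugeAct (u 0) ⁻¹' A) := by
  filter_upwards [condLaw_towerMap_map_gaugeAct_ae_eq av havg lvl k hr u hu] with V hV
  rw [← hV, Measure.map_apply (measurable_gaugeAct (u 0)) hA]

/-- Integrand form (`ℝ≥0∞`): `∫⁻ f d(condLaw dU towerMap (V^{u k})) = ∫⁻ U, f (U^{u 0}) d(condLaw dU towerMap V)` a.e. [folklore] -/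
theorem lintegral_condLaw_towerMap_gaugeAct_ae_eq (av : (i : ℕ) → Averaging P i G) (havg : ∀ i, Measurable (av i).avg) (lvl k : ℕ)
    (hr : lvl + k ≤ P.m + P.K) (u : (i : ℕ) → GaugeTransf P (lvl + i) G) (hu : ∀ i, i < k → u i = liftTransf (j := lvl + i) (u (i + 1)))
    {f : GaugeField P lvl G → ℝ≥0∞} (hf : Measurable f) :
    ∀ᵐ V ∂((fieldMeasure P lvl G).map (towerMap (fun i => (av i).avg) lvl k)),
      ∫⁻ U, f U ∂(condLaw (fieldMeasure P lvl G) (towerMap (fun i => (av i).avg) lvl k) (GaugeField.gaugeAct (u k) V))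
        = ∫⁻ U, f (GaugeField.gaugeAct (u 0) U) ∂(condLaw (fieldMeasure P lvl G) (towerMap (fun i => (av i).avg) lvl k) V) := by
  filter_upwards [condLaw_towerMap_map_gaugeAct_ae_eq av havg lvl k hr u hu] with V hV
  rw [← hV, lintegral_map hf (measurable_gaugeAct (u 0))]
  rfl

end Kernel

/-! ## §3 Densities: the tower's marginal density and kernel transport under `towerAC` -/

section Transport

variable [MeasurableSpace G] [HaarData G] [MeasurableMul₂ G] [StandardBorelSpace G]

omit [StandardBorelSpace G] in
/-- The tower's marginal density `d(towerMap_* dU)/dV` on level `lvl + k` is coarse-gauge invariant `dV`-a.e. [folklore] -/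
theorem margDensity_towerMap_gaugeAct_ae_eq (av : (i : ℕ) → Averaging P i G) (havg : ∀ i, Measurable (av i).avg) (lvl k : ℕ)
    (hr : lvl + k ≤ P.m + P.K) (u : (i : ℕ) → GaugeTransf P (lvl + i) G) (hu : ∀ i, i < k → u i = liftTransf (j := lvl + i) (u (i + 1))) :
    ∀ᵐ V ∂(fieldMeasure P (lvl + k) G),
      margDensity (fieldMeasure P lvl G) (fieldMeasure P (lvl + k) G) (towerMap (fun i => (av i).avg) lvl k) (GaugeField.gaugeAct (u k) V)
        = margDensity (fieldMeasure P lvl G) (fieldMeasure P (lvl + k) G) (towerMap (fun i => (av i).avg) lvl k) V := by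
  let S : GaugeField P (lvl + k) G ≃ᵐ GaugeField P (lvl + k) G :=
    { toFun := GaugeField.gaugeAct (u k)
      invFun := GaugeField.gaugeAct (invTransf (u k))
      left_inv := gaugeAct_inv_gaugeAct (u k)
      right_inv := gaugeAct_gaugeAct_inv (u k)
      measurable_toFun := measurable_gaugeAct (u k)
      measurable_invFun := measurable_gaugeAct (invTransf (u k)) }
  exact margDensity_comp_ae_eq (fieldMeasure P lvl G) (fieldMeasure P (lvl + k) G) (measurable_towerMap _ havg lvl k)
    (measurable_gaugeAct (u 0)) S (towerMap_gaugeAct av lvl k hr u hu) (measurePreserving_gaugeAct (u 0)).map_eq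
    (measurePreserving_gaugeAct (u k)).map_eq

/-- ★ **THE `k`-STEP KERNEL TRANSPORT COMMUTES WITH COARSE GAUGE TRANSFORMATIONS, FOR EVERY MEASURABLE DENSITY**: under one-step `HaarAC` at every level of the
tower (`towerAC`), for `dV`-a.e. `V` on level `lvl + k`, `(T_k ρ)(V^{u k}) = (T_k (U ↦ ρ(U^{u 0})))(V)`. [folklore] -/
theorem kernelTransport_towerMap_gaugeAct_ae_eq (av : (i : ℕ) → Averaging P i G) (havg : ∀ i, Measurable (av i).avg) (lvl k : ℕ)
    (hr : lvl + k ≤ P.m + P.K) (hac : ∀ i, i < k → HaarAC (av (lvl + i)).avg)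
    (u : (i : ℕ) → GaugeTransf P (lvl + i) G) (hu : ∀ i, i < k → u i = liftTransf (j := lvl + i) (u (i + 1)))
    {ρ : GaugeField P lvl G → ℝ} (hρ : Measurable ρ) :
    ∀ᵐ V ∂(fieldMeasure P (lvl + k) G),
      kernelTransport (fieldMeasure P lvl G) (fieldMeasure P (lvl + k) G) (towerMap (fun i => (av i).avg) lvl k) ρ (GaugeField.gaugeAct (u k) V)
        = kernelTransport (fieldMeasure P lvl G) (fieldMeasure P (lvl + k) G) (towerMap (fun i => (av i).avg) lvl k)
            (ρ ∘ GaugeField.gaugeAct (u 0)) V := by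
  let S : GaugeField P (lvl + k) G ≃ᵐ GaugeField P (lvl + k) G :=
    { toFun := GaugeField.gaugeAct (u k)
      invFun := GaugeField.gaugeAct (invTransf (u k))
      left_inv := gaugeAct_inv_gaugeAct (u k)
      right_inv := gaugeAct_gaugeAct_inv (u k)
      measurable_toFun := measurable_gaugeAct (u k)
      measurable_invFun := measurable_gaugeAct (invTransf (u k)) }
  exact kernelTransport_apply_ae_eq (fieldMeasure P lvl G) (fieldMeasure P (lvl + k) G) (measurable_towerMap _ havg lvl k)
    (towerAC (fun i => (av i).avg) havg lvl k hac) (measurable_gaugeAct (u 0)) S (towerMap_gaugeAct av lvl k hr u hu)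
    (measurePreserving_gaugeAct (u 0)).map_eq (measurePreserving_gaugeAct (u k)).map_eq hρ

end Transport

/-! ## §4 Instances at Bałaban's exp-mean-log block averaging (0.4) on `SU(N)` — the averaging of record, unconditional in the standing range -/

section SUN

open BlockAveraging ExpMeanLog BlockAveragingEMLFibreLawSUN
open T4AveragingDisintegration (avgKernel transportK)

variable {N : ℕ} [NeZero N] {P : Params} {j : ℕ}

/-- ★ **THE AVERAGING KERNEL OF BAŁABAN'S BLOCK AVERAGING (0.4) ON `SU(N)` IS GAUGE-EQUIVARIANT**, every `N ≥ 1`, every torus of the standing range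
`j + 1 ≤ m + K` (file 10 ★★ at `blockAvg expMeanLogSU`; measurability `BlockAveraging.measurable_avgFun _ measurable_expMeanLogSU_E`). [folklore] -/
theorem avgKernel_expMeanLogSU_map_gaugeAct_ae_eq (hj : j + 1 ≤ P.m + P.K) (v : GaugeTransf P (j + 1) (Matrix.specialUnitaryGroup (Fin N) ℂ)) :
    ∀ᵐ V ∂((fieldMeasure P j (Matrix.specialUnitaryGroup (Fin N) ℂ)).map
        (avgFun (expMeanLogSU : LoopAverage (Matrix.specialUnitaryGroup (Fin N) ℂ)) :
          GaugeField P j (Matrix.specialUnitaryGroup (Fin N) ℂ) → GaugeField P (j + 1) (Matrix.specialUnitaryGroup (Fin N) ℂ))),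
      (avgKernel (avgFun (expMeanLogSU : LoopAverage (Matrix.specialUnitaryGroup (Fin N) ℂ)) :
          GaugeField P j (Matrix.specialUnitaryGroup (Fin N) ℂ) → GaugeField P (j + 1) (Matrix.specialUnitaryGroup (Fin N) ℂ)) V).map
          (GaugeField.gaugeAct (liftTransf v))
        = avgKernel (avgFun (expMeanLogSU : LoopAverage (Matrix.specialUnitaryGroup (Fin N) ℂ)) :
          GaugeField P j (Matrix.specialUnitaryGroup (Fin N) ℂ) → GaugeField P (j + 1) (Matrix.specialUnitaryGroup (Fin N) ℂ))
          (GaugeField.gaugeAct v V) :=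
  avgKernel_map_gaugeAct_ae_eq hj (blockAvg (expMeanLogSU : LoopAverage (Matrix.specialUnitaryGroup (Fin N) ℂ)))
    (measurable_avgFun _ measurable_expMeanLogSU_E) v

/-- ★ **THE ONE-STEP RENORMALIZATION TRANSFORM OF (0.4) ON `SU(N)` (kernel form `transportK`) COMMUTES WITH COARSE GAUGE TRANSFORMATIONS, EVERY MEASURABLE
DENSITY** — `HaarAC` unconditional by `BlockAveragingEMLFibreLawSUN.haarAC_avgFun_expMeanLogSU_SUN`. [folklore] -/
theorem transportK_expMeanLogSU_gaugeAct_ae_eq (hj : j + 1 ≤ P.m + P.K) (v : GaugeTransf P (j + 1) (Matrix.specialUnitaryGroup (Fin N) ℂ))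
    {ρ : GaugeField P j (Matrix.specialUnitaryGroup (Fin N) ℂ) → ℝ} (hρ : Measurable ρ) :
    ∀ᵐ V ∂(fieldMeasure P (j + 1) (Matrix.specialUnitaryGroup (Fin N) ℂ)),
      transportK (avgFun (expMeanLogSU : LoopAverage (Matrix.specialUnitaryGroup (Fin N) ℂ)) :
          GaugeField P j (Matrix.specialUnitaryGroup (Fin N) ℂ) → GaugeField P (j + 1) (Matrix.specialUnitaryGroup (Fin N) ℂ)) ρ
          (GaugeField.gaugeAct v V)
        = transportK (avgFun (expMeanLogSU : LoopAverage (Matrix.specialUnitaryGroup (Fin N) ℂ)) :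
          GaugeField P j (Matrix.specialUnitaryGroup (Fin N) ℂ) → GaugeField P (j + 1) (Matrix.specialUnitaryGroup (Fin N) ℂ))
          (ρ ∘ GaugeField.gaugeAct (liftTransf v)) V :=
  transportK_gaugeAct_ae_eq hj (blockAvg (expMeanLogSU : LoopAverage (Matrix.specialUnitaryGroup (Fin N) ℂ)))
    (measurable_avgFun _ measurable_expMeanLogSU_E) (haarAC_avgFun_expMeanLogSU_SUN hj) v hρ

end SUN

end Summit.QuantumFields.YangMills.Theorems.N21AvgKernelEquivariance

end
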